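import Summits.NavierStokesRegularity.NavierStokesRegularity.Theorems.SwirlHolderTowerFunnel
import Literature.Analysis.FluidPDE.SelfSimilar
import Literature.Analysis.FluidPDE.AxisymmetricEuler
import Literature.Analysis.FluidPDE.LeraySelfSimilarCalculus
import Literature.Analysis.FluidPDE.TaoEnstrophyLocalisation
import Literature.Analysis.FluidPDE.SwirlTransportProofs
import Literature.Analysis.FluidPDE.AxisymmetricVorticityTransport
import Literature.Analysis.PDE.LoewnerNirenbergKelvin
import Literature.Analysis.PDE.LoewnerNirenbergFactsProofs
import HarnessLib


/-!
# ROUND-21 (nsreg-p2, gen 23) — THE SHEET LAWS: the material form of the contrast principle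
# Part 1/4: the odd-swirl class, `χ = Γ/z`, S-21.1 (support statement), S-21.2 (proved from S-21.1)

Landed for the planner seat nsreg-p2 (gen 23) by the prover seat nsreg-p4 (gen 14) as route-line
material of `SwirlThreshold` (`--supports stmt-NavierStokesRegularity-2002`): the text of the declarations is
VERBATIM the planner's companion `HOME/ns-regularity-ideate-p2/R21-SheetLaws.lean` (v8, sha16
e3c548b310767775), split into files of ≤ 400 lines (this file: §§1–4; §5 = `SheetLawsMeridionalLedger`, §§6–7 = `SheetLawsOddContrastEquation`, §§8–9 = `SheetLawsMeridionalEquation`).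

Companion of `HOME/ns-regularity-ideate-p2/ROUND-21.md` (planner nsreg-p2, gen 23).  LINE material
for the route `SwirlThreshold` (crux `SmallSwirlRegularity`, stmt-NavierStokesRegularity-2002);
nothing here is a Navier–Stokes regularity claim.

MECHANISM.  ROUND-20 showed, inside the separable conical class, that a converging inflow sheet
(the funnel `u_N`, inflow `-P/r` along `z = 0`, jets `2P/ρ` up the axis, `N = 2P`) must be PAID
for by z-contrast of `Γ²` across the sheet — `½ r² ∂_z²(Γ²)|_{z=0} = 12(P²+P) = 3N²+6N` at every
scale (kit j285699 [A3], re-deriving ROUND-16's identity as `τ_N(r) = ∂_z Res_η|₀ = 24P(P+1)/r⁶`)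
— and that the slowly-decaying (Arrhenius) swirl mode is a contrast-free plateau.  THIS ROUND
replaces the eigen-mode bookkeeping by two PDE identities valid for every axisymmetric classical
solution in the z-symmetric classes (kit j285699 [A1]–[A4], sympy, residual `0`; [A1] is moreover
KERNEL-CERTIFIED in §6, `oddContrast_transport`, from the tree's `Fluid.swirl_transport_holds`):

* ODD-SWIRL CLASS (Hou 2022's symmetry: `u_r` even, `u_z`, `u_θ` odd in `z` = equivariance under
  the half-turn about a horizontal axis, `IsOddSwirlClass`).  The ODD CONTRAST `χ := Γ/z`
  (`oddContrast`) solves the SOURCE-FREE drift–diffusion equation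
  `∂_t χ + u·∇χ + (u_z/z) χ = ν(∂_r² - r⁻¹∂_r + ∂_z² + 2z⁻¹∂_z) χ`,
  hence the maximum principle `‖χ(t)‖_∞ ≤ ‖χ(s)‖_∞ · exp ∫_s^t ‖(u_z/z)⁻‖_∞`
  (`OddContrastMaxPrinciple`, support statement): odd contrast is created ONLY by vertical
  COMPRESSION toward the sheet (`sheetCompression = -u_z/z > 0`).  The funnel itself has
  `u_z/z = 2P z²/ρ⁴ ≥ 0` — it only stretches away from its sheet (compression budget `0`), while
  paying its toll in this class needs `|χ|_{sheet} = √(12(P²+P))/r`, growing like `1/r` inward.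
  Consequences: the paid depth below the innermost compression radius `R_c` is at most
  `ln(‖χ‖_∞ R_c/√(12(P²+P)))` e-folds (`depth_le_log_add_budget`, exponent `1` EXACTLY — the
  material limit of ROUND-20's pencil exponent `α₁ = 1 + O(1/P)`), and — the law of this round —
  any blow-up in this class whose odd contrast grows at the self-similar rate must compress toward
  its sheet at dimensionless rate `(T-t)‖(u_z/z)⁻‖_∞ ≥ ½` on average; for a `λ`-DSS blow-up the
  per-period compression budget is `≥ ln λ` (`OddClassDSSCompressionLaw`, PROVED here from the
  maximum principle: `oddClassDSSCompressionLaw_of_maxPrinciple`; arithmetic cores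
  `log_factor_le_budget`, `half_log_le_budget`).

* EVEN-SWIRL CLASS (classical reflection symmetry).  Paying needs a TROUGH of `|Γ|` across the
  sheet (`Γ κ = 12(P²+P)/r² > 0`, `κ = ∂_z²Γ|₀`), but the sheet-curvature equation
  `∂_t κ + u_r ∂_r κ + 2σκ = ν[(∂_r² - r⁻¹∂_r)κ + ∂_z⁴Γ|₀] - (∂_z²u_r)|₀ ∂_rΓ|₀` ([A4]) is forced
  only by `-(∂_z²u_r)(∂_rΓ)`: an inflow sheet (`∂_z²u_r|₀ = 6P/r³ > 0` for the funnel) carrying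
  swirl that increases outward builds a RIDGE.  Exactly: every separable steady mode
  `Γ = ρ^α g(z/ρ)` in the funnel drift has `κ = -α(P+α-2) g(0) r^{α-2} < 0` for `α > 0`, `P > 2`
  (ROUND-20's `plateau_sign_defect`, now for all exponents; [A4] residual `0`).

Q21 of R21-PREP (jet-to-core transfer) EXECUTED ([A5], [B]): at exponent `0` the swirl pencil has
the integrating factor `e^{Pt²/2}` (`(e^{-Pt²/2}G')' = -s e^{-Pt²/2}/(1-t²)`), so a source supported
in the polar caps `|t| ≥ t₁` produces core slope `G'(t) = C e^{Pt²/2}` with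
`|C| ≤ max|G'| · e^{-c P t₁²/2}`, `c ∈ [1.05, 2.6]` measured over `P ∈ [8,72]`, `t₁ ∈ [0.6, 0.97]`,
`μ ∈ {0, ±0.5, 1.4i, 2.8i}` (closed form = collocation to 4 digits; even sources create NO core
contrast at `μ = 0`, exactly).  Granting the jet-core oscillation of R21-PREP §4d a polar swirl slope
as large as `2P^{3/2}`, the induced sheet slope is `≤ 5.5·10⁻²` of the need at `P = 8` and
`≤ 10⁻²` for `P ≥ 16`: no swirl-mediated payment.  What is NOT excluded is stated in the memo (§5:
direct Reynolds-stress payment by O(1)-amplitude core eddies — outside every perturbative class).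

hard core evaded: all eight — no statement below decides 0056, 10661, 16274, 15453, 1964, 0893,
0898 or 1217; the laws are necessary conditions on odd-class and even-class scenarios (they push the
odd-class scenario toward the one-scale, Type-I-geometry corner where `AxisymmetricTypeIExclusion`
and `NearOneDssTypeIExclusion` already stand, and name the number a DSS profile must exceed).

WHAT THIS IS NOT: not a regularity criterion (sign-restricted one-entry quantities of `∇u` are in
print: Neustupa–Penel 2002, Penel–Pokorný 2004, Cao–Titi 2011 — Lemarié-Rieusset 2016 p. 354), not a
claim about Hou's computation, not a proof of any route item.
-/

namespace Summit.NavierStokesRegularity.NavierStokesRegularity.Theorems.SheetLaws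

open MeasureTheory Set Filter Topology Metric WithLp
open scoped ENNReal NNReal
open Literature.Analysis Literature.Analysis.FluidPDE

noncomputable section
/-! ## 1. The odd-swirl class, the odd contrast `χ = Γ/z`, the sheet compression `-u_z/z` -/

/-- The half-turn about the horizontal `x₀`-axis, `(x₀, x₁, x₂) ↦ (x₀, -x₁, -x₂)` (a proper
rotation: z-reflection composed with the reflection through a meridional plane). -/
def halfTurn (x : EuclideanSpace ℝ (Fin 3)) : EuclideanSpace ℝ (Fin 3) := toLp 2 ![x 0, -x 1, -x 2]

/-- The half-turn keeps the first coordinate. -/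
@[simp] theorem halfTurn_apply_zero (x : EuclideanSpace ℝ (Fin 3)) : halfTurn x 0 = x 0 := rfl
/-- The half-turn flips the second coordinate. -/
@[simp] theorem halfTurn_apply_one (x : EuclideanSpace ℝ (Fin 3)) : halfTurn x 1 = -x 1 := rfl
/-- The half-turn flips the third coordinate (the height `z`). -/
@[simp] theorem halfTurn_apply_two (x : EuclideanSpace ℝ (Fin 3)) : halfTurn x 2 = -x 2 := rfl

/-- **The odd-swirl z-symmetric class** (Hou 2022's symmetry, arXiv:2107.06509 §2: `u₁ = u_θ/r`,
`ω₁`, `ψ₁` odd in `z`; for an axisymmetric field: `u_r` even, `u_z` odd, `u_θ` ODD in `z`):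
equivariance under the half-turn about a horizontal axis.  (The classical reflection class has
`u_θ` even instead; both are invariant classes of axisymmetric Navier–Stokes, the swirl equation
being linear in `u_θ` and the meridional equations quadratic in it.) -/
def IsOddSwirlClass (v : EuclideanSpace ℝ (Fin 3) → EuclideanSpace ℝ (Fin 3)) : Prop :=
  ∀ x, v (halfTurn x) = halfTurn (v x)

/-- **The odd contrast** `χ = Γ/z = (x₀ v₁ - x₁ v₀)/x₂` (junk value `0` on the sheet `x₂ = 0`, where
`Γ` vanishes in the odd class and the true value is `∂_z Γ`). -/
def oddContrast (v : EuclideanSpace ℝ (Fin 3) → EuclideanSpace ℝ (Fin 3))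
    (x : EuclideanSpace ℝ (Fin 3)) : ℝ :=
  swirl v x / x 2

/-- **The sheet compression rate** `-u_z/z` (positive where the flow moves TOWARD the plane `z = 0`;
on the sheet its true value is `-∂_z u_z`; junk `0` at `x₂ = 0`).  For the funnel `u_N`:
`u_z/z = 2P z²/(r²+z²)² ≥ 0` — no compression anywhere (kit j285699 [A2]). -/
def sheetCompression (v : EuclideanSpace ℝ (Fin 3) → EuclideanSpace ℝ (Fin 3))
    (x : EuclideanSpace ℝ (Fin 3)) : ℝ :=
  -(v x 2 / x 2)

/-- `Γ` is scale invariant: the swirl of the rescaled field `y ↦ c·v(c y)` at `x` is `Γ(c x)`. -/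
theorem swirl_rescale (c : ℝ) (v : EuclideanSpace ℝ (Fin 3) → EuclideanSpace ℝ (Fin 3))
    (x : EuclideanSpace ℝ (Fin 3)) :
    swirl (fun y => c • v (c • y)) x = swirl v (c • x) := by
  simp only [swirl, PiLp.smul_apply, smul_eq_mul]
  ring

/-- `χ` has scaling dimension `-1`: `χ[c·v(c·)](x) = c · χ[v](c x)` (`c ≠ 0`). -/
theorem oddContrast_rescale {c : ℝ} (hc : c ≠ 0)
    (v : EuclideanSpace ℝ (Fin 3) → EuclideanSpace ℝ (Fin 3)) (x : EuclideanSpace ℝ (Fin 3)) :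
    oddContrast (fun y => c • v (c • y)) x = c * oddContrast v (c • x) := by
  unfold oddContrast
  rw [swirl_rescale]
  simp only [PiLp.smul_apply, smul_eq_mul]
  by_cases hx : x 2 = 0
  · simp [hx]
  · field_simp

/-- `-u_z/z` has scaling dimension `-2`: `k[c·v(c·)](x) = c² · k[v](c x)` (`c ≠ 0`). -/
theorem sheetCompression_rescale {c : ℝ} (hc : c ≠ 0)
    (v : EuclideanSpace ℝ (Fin 3) → EuclideanSpace ℝ (Fin 3)) (x : EuclideanSpace ℝ (Fin 3)) :
    sheetCompression (fun y => c • v (c • y)) x = c ^ 2 * sheetCompression v (c • x) := by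
  unfold sheetCompression
  simp only [PiLp.smul_apply, smul_eq_mul]
  by_cases hx : x 2 = 0
  · simp [hx]
  · field_simp

/-! ## 2. The maximum principle for the odd contrast (support statement) -/

/-- **ODD-CONTRAST MAXIMUM PRINCIPLE** (support statement; the classical parabolic maximum
principle for `χ = Γ/z`, which is smooth by Hadamard's lemma and solves the SOURCE-FREE equation
`∂_t χ + u·∇χ + (u_z/z)χ = ν(Δ - 2r⁻¹∂_r + 2z⁻¹∂_z)χ` — kit j285699 [A1], symbolic residual `0`,
and THEOREM `oddContrast_transport` of §6, derived in the kernel from `Fluid.swirl_transport_holds`):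
for a classical solution in the odd-swirl class on `[s, t]`, decaying at spatial infinity uniformly
on `[s, t]`, `|χ(t, x)| ≤ C₀ exp(∫_s^t k)` whenever `|χ(s, ·)| ≤ C₀` and `-u_z/z ≤ k(τ)` off the
sheet.  Odd contrast is created only by compression toward the sheet.  (With general data the
χ-equation acquires the source `-(u^a_r/z)∂_rΓ_e - u^a_z(∂_zΓ_e/z)` from the antisymmetric
meridional flow acting on the even swirl — [A1], second identity.)   (v8: the majorant `k` is taken CONTINUOUS on `[s,t]`, so that `K = ∫ k ∈ C¹` and the
classical time-balance tools of the tree apply verbatim; the DSS laws below use explicit continuous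
rates, so nothing downstream is lost.  The integrable-`k` version — `K` only absolutely continuous —
is true as well but needs an AC chain rule the tree does not have.) -/
def OddContrastMaxPrinciple : Prop :=
  ∀ (S : Set ℝ) (ν : ℝ), 0 < ν →
  ∀ (u : ℝ → EuclideanSpace ℝ (Fin 3) → EuclideanSpace ℝ (Fin 3))
    (p : ℝ → EuclideanSpace ℝ (Fin 3) → ℝ), IsClassicalNSSolutionOn S ν 0 u p →
  ∀ (s t : ℝ), s ≤ t → Icc s t ⊆ S →
    (∀ τ ∈ Icc s t, IsAxisymmetric (u τ) ∧ IsOddSwirlClass (u τ)) →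
    (∀ ε : ℝ, 0 < ε → ∃ R : ℝ, ∀ τ ∈ Icc s t, ∀ x : EuclideanSpace ℝ (Fin 3),
        R ≤ ‖x‖ → |oddContrast (u τ) x| ≤ ε) →
    ∀ (C₀ : ℝ) (k : ℝ → ℝ),
      (∀ x, |oddContrast (u s) x| ≤ C₀) →
      (∀ τ ∈ Icc s t, ∀ x : EuclideanSpace ℝ (Fin 3), x 2 ≠ 0 → sheetCompression (u τ) x ≤ k τ) →
      ContinuousOn k (Icc s t) →
      ∀ x, |oddContrast (u t) x| ≤ C₀ * Real.exp (∫ τ in s..t, k τ)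

/-! ## 3. Arithmetic cores (proved) -/

/-- **PAID DEPTH ≤ log(initial contrast / need) + compression budget.**  If paying the sheet toll
at radius `r` needs contrast `b/r` (`b = √(12(P²+P))` for the funnel) and the contrast available is
at most `C₀ e^Λ` (maximum principle, `Λ` = compression budget), then the paid range below a
reference radius `R` spans at most `ln(R C₀/b) + Λ` e-folds: exponent ONE exactly (ROUND-20 had the
pencil's `α₁ = 1 + O(1/P)` in the denominator). -/
theorem depth_le_log_add_budget {b r R C₀ Λ : ℝ} (hb : 0 < b) (hr : 0 < r) (hR : 0 < R)
    (hC : 0 < C₀) (h : b / r ≤ C₀ * Real.exp Λ) :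
    Real.log (R / r) ≤ Real.log (R * C₀ / b) + Λ := by
  have h1 : b / r ≤ C₀ * Real.exp Λ := h
  have h2 : R / r = R * C₀ / b * (b / r / C₀) := by
    field_simp
  have hpos : 0 < b / r / C₀ := by positivity
  have h3 : b / r / C₀ ≤ Real.exp Λ := by
    rw [div_le_iff₀ hC]; linarith [mul_comm C₀ (Real.exp Λ)]
  rw [h2, Real.log_mul (by positivity) hpos.ne']
  have h4 : Real.log (b / r / C₀) ≤ Λ := by
    have := Real.log_le_log hpos h3
    rwa [Real.log_exp] at this
  linarith

/-- **One DSS period costs `ln λ` of compression**: if a positive quantity is multiplied by `λ`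
over a period on which the maximum principle allows at most the factor `e^K`, then `ln λ ≤ K`. -/
theorem log_factor_le_budget {m lam K : ℝ} (hm : 0 < m) (hl : 0 < lam)
    (h : lam * m ≤ m * Real.exp K) : Real.log lam ≤ K := by
  have h1 : lam ≤ Real.exp K := by
    have h' : lam * m ≤ Real.exp K * m := by rwa [mul_comm m] at h
    exact le_of_mul_le_mul_right h' hm
  calc Real.log lam ≤ Real.log (Real.exp K) := Real.log_le_log hl h1
    _ = K := Real.log_exp K

/-- **Continuous form: self-similar contrast growth costs compression at rate `½` per unit of
`ln(1/(T-t))`.**  If the odd contrast is at least `m₀ (T-t)^{-1/2}` (self-similar growth) while the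
maximum principle caps it by `M₀ e^{B(t)}`, `B(t) = ∫₀ᵗ ‖(u_z/z)⁻‖_∞`, then
`½ ln(1/(T-t)) ≤ B(t) + ln(M₀/m₀)`: the compression budget must diverge logarithmically, with
coefficient at least `½` — i.e. `(T-t)·‖(u_z/z)⁻(t)‖_∞ ≥ ½` on (logarithmic) average. -/
theorem half_log_le_budget {m₀ M₀ T t B : ℝ} (hm : 0 < m₀) (hM : 0 < M₀) (hT : 0 < T - t)
    (h : m₀ * (T - t) ^ (-(1 / 2 : ℝ)) ≤ M₀ * Real.exp B) :
    1 / 2 * Real.log (1 / (T - t)) ≤ B + Real.log (M₀ / m₀) := by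
  have hpow : 0 < (T - t) ^ (-(1 / 2 : ℝ)) := Real.rpow_pos_of_pos hT _
  have hlhs : 0 < m₀ * (T - t) ^ (-(1 / 2 : ℝ)) := mul_pos hm hpow
  have h1 := Real.log_le_log hlhs h
  rw [Real.log_mul hm.ne' hpow.ne', Real.log_rpow hT, Real.log_mul hM.ne' (Real.exp_pos B).ne',
    Real.log_exp] at h1
  rw [one_div (T - t), Real.log_inv, Real.log_div hM.ne' hm.ne']
  linarith

/-! ## 4. The sheet-compression law for discretely self-similar blow-up in the odd class -/

/-- **ODD-CLASS DSS SHEET-COMPRESSION LAW.**  Let `u` be a classical solution on `(-∞, 0)` which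
is `λ`-DSS (`λ u(λ²t, λx) = u(t,x)`, `1 < λ`; the tree's `IsDiscretelySelfSimilar`), axisymmetric
and in the odd-swirl class on the period `[-λ², -1]`, with odd contrast decaying at spatial infinity
uniformly on the period, bounded and not identically zero at time `-λ²`.  Then every majorant `k`
of the sheet compression `-u_z/z` on the period has `∫_{-λ²}^{-1} k ≥ ln λ`: in self-similar time
`s = -ln(-t)` (period `2 ln λ`) the dimensionless compression `(-t)‖(u_z/z)⁻‖_∞` averages at least
`½`.  A DSS blow-up profile in Hou's symmetry class must transport fluid TOWARD its symmetry plane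
at least at half the self-similar rate, somewhere, on average over each period.  (By the scaling
covariance `χ_λ(t,x) = λ χ(λ²t, λx)` the contrast sup is multiplied by exactly `λ` per period, while
the maximum principle allows at most `exp ∫ k`.)  Test T-21.3 of the memo asks for this number in
Hou's 2022 computation. -/
def OddClassDSSCompressionLaw : Prop :=
  ∀ (lam ν : ℝ), 1 < lam → 0 < ν →
  ∀ (u : ℝ → EuclideanSpace ℝ (Fin 3) → EuclideanSpace ℝ (Fin 3))
    (p : ℝ → EuclideanSpace ℝ (Fin 3) → ℝ),
    IsClassicalNSSolutionOn (Iio 0) ν 0 u p → IsDiscretelySelfSimilar lam u →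
    (∀ τ ∈ Icc (-lam ^ 2) (-1), IsAxisymmetric (u τ) ∧ IsOddSwirlClass (u τ)) →
    (∀ ε : ℝ, 0 < ε → ∃ R : ℝ, ∀ τ ∈ Icc (-lam ^ 2) (-1), ∀ x : EuclideanSpace ℝ (Fin 3),
        R ≤ ‖x‖ → |oddContrast (u τ) x| ≤ ε) →
    BddAbove (range fun x => |oddContrast (u (-lam ^ 2)) x|) →
    (∃ x, oddContrast (u (-lam ^ 2)) x ≠ 0) →
    ∀ k : ℝ → ℝ,
      (∀ τ ∈ Icc (-lam ^ 2) (-1), ∀ x : EuclideanSpace ℝ (Fin 3), x 2 ≠ 0 →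
          sheetCompression (u τ) x ≤ k τ) →
      ContinuousOn k (Icc (-lam ^ 2) (-1)) →
      Real.log lam ≤ ∫ τ in (-lam ^ 2)..(-1), k τ

/-- **The DSS law follows from the maximum principle** (proved: scaling covariance of `χ` + one
application of `OddContrastMaxPrinciple` over the period + `log_factor_le_budget`). -/
theorem oddClassDSSCompressionLaw_of_maxPrinciple (hMP : OddContrastMaxPrinciple) :
    OddClassDSSCompressionLaw := by
  intro lam ν hlam hν u p hsol hdss hsym hdec hbdd hnz k hk hint
  have hl0 : 0 < lam := by linarith
  have hst : -lam ^ 2 ≤ (-1 : ℝ) := by nlinarith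
  have hsub : Icc (-lam ^ 2) (-1 : ℝ) ⊆ Iio 0 := fun τ hτ => lt_of_le_of_lt hτ.2 (by norm_num)
  set m : ℝ := ⨆ x, |oddContrast (u (-lam ^ 2)) x| with hm_def
  have hm_le : ∀ x, |oddContrast (u (-lam ^ 2)) x| ≤ m := fun x =>
    le_ciSup (f := fun x => |oddContrast (u (-lam ^ 2)) x|) hbdd x
  have hmax := hMP (Iio 0) ν hν u p hsol (-lam ^ 2) (-1) hst hsub hsym hdec m k hm_le hk hint
  -- scaling covariance of the odd contrast over one period
  have hscale : ∀ x, oddContrast (u (-1)) x = lam * oddContrast (u (-lam ^ 2)) (lam • x) := by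
    intro x
    have hfun : u (-1) = fun y => lam • u (-lam ^ 2) (lam • y) := by
      funext y
      have h1 := congrFun (congrFun hdss (-1)) y
      rw [nsRescale_apply] at h1
      rw [← h1]
      congr 1
      ring_nf
    rw [hfun]
    exact oddContrast_rescale hl0.ne' _ _
  -- positivity of the sup
  obtain ⟨x₀, hx₀⟩ := hnz
  have hm_pos : 0 < m := lt_of_lt_of_le (abs_pos.mpr hx₀) (hm_le x₀)
  -- the sup at time -1 is `lam * m`, and the maximum principle caps it by `m * exp K`
  have hkey : ∀ x, lam * |oddContrast (u (-lam ^ 2)) x| ≤ m * Real.exp (∫ τ in (-lam ^ 2)..(-1), k τ) := by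
    intro x
    have h1 := hmax (lam⁻¹ • x)
    rw [hscale, smul_smul, mul_inv_cancel₀ hl0.ne', one_smul, abs_mul, abs_of_pos hl0] at h1
    exact h1
  have hsup : lam * m ≤ m * Real.exp (∫ τ in (-lam ^ 2)..(-1), k τ) := by
    have h2 : ∀ x, |oddContrast (u (-lam ^ 2)) x| ≤
        m * Real.exp (∫ τ in (-lam ^ 2)..(-1), k τ) / lam := by
      intro x
      rw [le_div_iff₀ hl0, mul_comm]
      exact hkey x
    have h3 : m ≤ m * Real.exp (∫ τ in (-lam ^ 2)..(-1), k τ) / lam := ciSup_le h2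
    rwa [le_div_iff₀ hl0, mul_comm] at h3
  exact log_factor_le_budget hm_pos hl0 hsup


end

end Summit.NavierStokesRegularity.NavierStokesRegularity.Theorems.SheetLaws
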